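import Mathlib
import HarnessLib

/-!
# Hintz 2026, Thm 7.1(3) / eq. (7.8): the indicial roots of the constraint propagation wave operator —
# kernel reproduction of the companion computation [CD] Thm 4.9 / Cor 4.7 / Appendix A

CITATION HEADER (lean-in-tree rule 2026-08-18).  Two UNREFEREED preprints by P. Hintz (2026):
* `Hintz2026` = *Nonlinear stability of subextremal Kerr black holes*, arXiv:2606.28253 **v2** — the CLAIM under
  adjudication in this library (`Literature.Geometry.Lorentzian.hintz_kerr_stability_subextremal_cauchy`,
  `@[claim "Hintz2026" "under-review"]`); TeX lines `H l.N` = its source `kerr-stab-r.tex`;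
* `HintzCD2026` = *Constraint damping on subextremal Kerr spacetimes*, arXiv:2606.27658 **v1** (157 pp.) — the
  companion "[CD]" whose results Hintz 2026 imports, as a black box, in its Thm 7.1 (`ThmWCRec`, H l.6820–6835, p. 136:
  "We summarize the main results from [CD] (in the slightly weakened form sufficient for our purposes)"); TeX lines
  `CD l.N` = its arXiv source `kerr-cd.tex` (e-print of 2026-06-29, sha256 of the e-print `f0fccc2c2148…`).
Neither paper is refereed (2026-08-19).  This file does NOT certify any analytic statement of either paper.  It
REPRODUCES, in the kernel, the finite algebra behind [CD] Thm 4.9 (`ThmM0`, CD l.2419–2429, p. 41) = the source of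
Hintz 2026 Thm 7.1(3) (H l.6831) and of the root LIST eq. (7.8) `EqWCIndRoots` (H l.6837–6846), and it PROVES, with
explicit thresholds, the two parts of [CD] Thm 4.9 that [CD] itself settles by explicit formulas or a short argument
(vector type, CD App. A.1; scalar type 0, CD App. A.2).  The scalar type `l ≥ 1` part (CD App. A.3, a six-regime
asymptotic analysis of a sextic, CD l.4020–4450) is NOT proved here; for it the file certifies the sextic itself, the
root `1` and its simplicity at `l = 1`, and the printed face polynomials / implicit-derivative values of regimes (N1),
(P1), (P2), (P4).  Written by the audit cell `pub-kerr` (HINTZ-PLAN.md T5(c) / R4′); three further engines agree with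
every identity below (`run/shared/lean/pub/pub-kerr/code/adep1-g14/`: sympy symbolic incl. a FIRST-PRINCIPLES
derivation of the operator from the Minkowski metric; exact-rational; numeric).

## What is printed (verbatim shape)

[CD] Cor 4.7 (`CorM00`, CD l.2361–2386, p. 40; reprinted as Hintz 2026 eq. (7.6) `EqWCRecBox0`, H l.6803–6816 with
`(v, e, h⁻¹) = (v^𝓒, e^𝓒, γ^𝓒)`): in the splitting `T*ℝ⁴ = ⟨dx⁰⟩ ⊕ ⟨dx¹⟩ ⊕ r T*𝕊²` (`x⁰ = t + r`, `x¹ = t − r`),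
`ρ⁻² □̂^{𝒞_{v,e,h}}(0) = −(ρ∂_ρ)² + ρ∂_ρ + Δ̸ + [[1,−1,−δ̸],[−1,1,δ̸],[−2d̸,2d̸,1]] + h⁻¹[q_{••}]` with
`q₀₀ = (1−3v+e+ev)ρ∂_ρ + (−1+3v+e+ev)`, `q₁₀ = (1−e)(1+v)ρ∂_ρ − (1+e)(1+v)`, `q_{/0} = −2e(1+v)d̸`,
`q₀₁ = −(1−e)(1−v)ρ∂_ρ + (1+e)(1−v)`, `q₁₁ = (−1−3v−e+ev)ρ∂_ρ + (1+3v−e+ev)`, `q_{/1} = −2e(1−v)d̸`,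
`q_{0/} = (1−v)δ̸`, `q_{1/} = (1+v)δ̸`, `q_{//} = −2vρ∂_ρ + 4v`.  The indicial family `N_{v,e,h}(λ)` (CD (4.19)
`EqM0NormOp`) replaces `ρ∂_ρ` by `λ`; on scalar type `l` sections `(a𝕐, b𝕐, c d̸𝕐)` one substitutes
`Δ̸ ↦ diag(L, L, L−1)`, `d̸ ↦ 1`, `δ̸ ↦ L` (`L = l(l+1)`; CD (A.1), App. A.3 l.4023–4028), on scalar type `0` sections
`(a, b, 0)` the upper `2 × 2` block with `Δ̸ ↦ 0` (App. A.2 l.3986–3990), on vector type sections `(0, 0, ⋆d̸𝕐)` the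
scalar `−λ² + λ + (L−1) + 1 + h⁻¹ q_{//}(λ)` (App. A.1 l.3814–3817).  Printed characteristic polynomials:
`p_v(h,l,λ) = −hλ² + (h−2v)λ + (l(l+1)h + 4v)` (CD l.3816), `p_{s0}(e,h,λ) = h²(λ−1)⁻¹ det N_{s0}(λ) = h²λ³ +
(2(3−e)hv − h²)λ² + (4(2−e)v² − 4e − 2(e+3)hv − 2h²)λ − 4((2+e)v² + e + hv)` (CD l.3991–3994), and the sextic
`p(e,h,l,λ) = −h³ det N_{s l}(λ)` of CD App. A.3, eq. (A.13) `EqMsPoly` (l.4029–4046) — transcribed in `pS` below.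
[CD] Thm 4.9: "Let `v ∈ (0,1)`. Then there exists `e₀ = e₀(v) ∈ (0,1)` such that for all `e ∈ (0,e₀)` there exists
`h₀ > 0` such that for all `h ∈ (0,h₀)`, all indicial roots `λ ∈ ℂ` … satisfy: (1) `Re λ ≥ 1` or `Re λ < −C₀`; (2) the
only root with `Re λ = 1` is `λ = 1`, which is only a root of scalar type `0` (of order `1`) and a scalar type `1` root
(also of order `1`); (3) there are precisely `1`, resp. `2`, resp. `3` vector type `l` (`l ≥ 1`), resp. scalar type `0`,
resp. scalar type `l` (`l ≥ 1`) roots with real parts `≥ 1`, and an equal number of roots with real parts `< −C₀`;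
(4) the real parts … accumulate only at `±∞` …" (`C₀` is not quantified in the printed statement; its proof fixes
`h₀` depending on `C₀`, CD l.3977 and l.4154).  Hintz 2026 (7.8): "`v1`: `−1 − 2v^𝓒γ^𝓒, 2`" (H l.6845) = CD l.3819.

## What is proved here (all over `ℝ`/`ℂ`; `L` a free real parameter unless stated)

1. `det_Msl`, `det_Ms0`, `Mv_eq`: with `Msl = h•N_{s l}(λ)`, `Ms0 = h•N_{s0}(λ)`, `Mv = h N_{v l}(λ)` (polynomial
   entries): `det Msl = −p`, `det Ms0 = (λ−1)·p_{s0}`, `Mv = p_v` — the printed polynomials ARE the determinants.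
2. `λ = 1`: `pS_L2_one` (`p(e,h,1,1) = 0`, CD l.4177), `pS_h0_one` (`p(e,0,l,1) = 0`), `det_Ms0_one`; SIMPLICITY
   (Thm 4.9(2) "of order 1"): `pS_L2_factor`/`Q5_one_pos` (`p(e,h,1,·) = (λ−1)Q₅` with `Q₅(1) = 4(3h³ + 9h²v + 4hv² +
   2ehv² + 6eh + 8ev) > 0`) and `pS0_one_neg` (`p_{s0}(e,h,1) = −(4(1+e)hv + 8ev² + 8e + 2h²) < 0`), for `e,h,v > 0`.
3. VECTOR TYPE, complete with an explicit threshold (CD App. A.1; CD l.3819 "the desired conclusion can then be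
   obtained by direct estimates" — here they are): for `h, v > 0`, `L ≥ 2`, `C ≥ 0` and `h(C−1) < 2v`:
   `pV_pos_of_mem` (`p_v > 0` on `[−C, 2)`), `pV_factor`/`pVC_factor` (`p_v(x) = −h(x−λ₋)(x−λ₊)` over `ℝ` and `ℂ` with
   `λ± = ((h−2v) ± √D)/(2h)`, `D = (h−2v)² + 4h(Lh+4v) > 0`), `lamMinus_lt` (`λ₋ < −C`), `two_le_lamPlus` (`2 ≤ λ₊`,
   `= 2` iff `L = 2`: `pV_two`), `vectorType_roots` (every complex root is `λ₋` or `λ₊`): exactly ONE root with real part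
   `≥ 1` (indeed `≥ 2`) and ONE with real part `< −C`, none non-real, `1` never a root — Thm 4.9 (1)–(3) for vector
   type, UNIFORMLY IN `l ≥ 1`, for EVERY `h < 2v/(C−1)` (no `e`-dependence); `hL_le` (`hL ≤ hλ₊² + 2vλ₊`, so
   `λ₊ → ∞` as `l → ∞`: Thm 4.9(4)); `pV_L2` (the `v1` roots `2, −1−2v/h` of H l.6845 / CD l.3819).
4. SCALAR TYPE 0, complete with explicit thresholds (CD App. A.2 proves it for "sufficiently small" `e`, then `h`):
   for `0 < v < 1`, `0 < e ≤ v²`, `C ≥ 0`, `0 < h` with `4h(C+1)² ≤ v`: `pS0_neg_on_Icc` (`p_{s0} < 0` on `[−C, 1]`),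
   sign probes `pS0_left_neg` (at `−(10v/h + 3)`), `pS0_mid_pos` (at `−3v/h`, between the printed leading orders
   `−4v/h`, `−2v/h` of CD l.4010–4013), `pS0_right_pos` (at `5/(1−v²)`), hence by the intermediate value theorem
   `scalarType0_roots`: three real roots `r₁ < r₂ < −C`, `1 < r₃` with `p_{s0}(z) = h²(z−r₁)(z−r₂)(z−r₃)` over `ℂ`
   (`pS0C_eq_prod`), so the `s0` indicial roots are exactly `r₁, r₂, 1, r₃`, all simple and real — Thm 4.9 (1)–(3) for
   scalar type `0` with `e₀ = v²`, `h₀ = v/(4(C₀+1)²)`; = Hintz's list "`λ^𝓒_{s0,≪,1}, λ^𝓒_{s0,≪,2}, 1, λ^𝓒_{s0,+}`".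
5. SCALAR TYPE `l ≥ 1` (partial): regime (N1) face `N1_rescale`/`N1_face`/`N1_face_e0` (CD l.4091–4103: `h³p(e,h,l,λ̆/h)`
   has smooth coefficients, restricts at `h = 0` to `λ̆³·(cubic)`, `= λ̆³(λ̆+4v)(λ̆+2v)²` at `e = 0`); regime (P1)
   `P1_factor` (`p(e,0,l,λ) = 8v(λ−1)p₁` with the printed `p₁`, eq. `EqMsP1p1` l.4181–4185), `p1_e0`
   (`p₁(0,l,λ) = 2v²(λ−2)(λ−1)`), and the two implicit-derivative values as first-order Taylor coefficients:
   `P1_taylor_e` + `P1_dE_value` (`∂_e λ_{1,1}|_{e=0} = ((1−v²)L + 2(1+v²))/(2v²)`, l.4193) and `P1_taylor_h` +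
   `P1_taylor_lam` + `P1_dH_value` (`∂_h λ₀|_{h=0} = L(L−2)(1−v²)/(2v((1−v²)L + 2(1+v²)))`, l.4203–4205, with the
   factor `e` cancelling exactly as the footnote l.4205 says; `P1_dH_value_l2`: its `l = 2` value is the printed lower
   bound `3(1−v²)/(v(2−v²))` and the printed `c` is `2/3` of it); the printed regime-(P2)/(P4) face cubics
   `P2_face_h0`, `P2_roots`, `P4_roots` (l.4248–4262, l.4353–4361) as identities about those printed cubics.

Deliberately NOT here: Thm 4.9 for scalar type `l ≥ 1` (regimes N2–N3, P2–P6 are certified only by the cell's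
engines A/B: symbolic cancellation and exact rational extrapolation to the faces), anything about the Kerr (non-model)
operator, the 1-form `𝔡` of CD Prop 5.1, and every analytic statement (CD Thms 5.2, 6.2, B.1; Hintz Thm 7.1 (1),
(2), (4)).  Engine datum recorded by the cell (DIVERGENCE.md EXT-G3, print-level, no effect on Thm 4.9): at CD's own
figure point `(v,e,h) = (½, 10⁻⁴, 10⁻⁶)` (Fig. `FigMsNumeric`, CD l.4069–4081) exact Sturm counts give non-real positive
scalar-type roots for `l ∈ [41, 48809]` (printed leading-order thresholds `40.8`, `48990`) AND for
`l ∈ [2770383, 4132002]` (`hl ∈ [2.77, 4.13]`, regime (P5), whose face polynomial has a double root), a second window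
the prose of regime (P4) (CD l.4062) does not mention; real parts there are `≈ 2.5·10⁶`.
v4 (docstring-only, audit seat adep1 gen 16): the §7 equation NUMBERS of Hintz 2026 are corrected to the v2 PDF
numbering — (7.6) `EqWCRecBox0`, (7.8) `EqWCIndRoots` (v1–v3 printed (7.5)/(7.7), one too low: the numbered display
(7.3) `EqWCRecE` had not been counted); every label and TeX-line locator was already right and is unchanged; no
declaration, statement or proof changed (cell DIVERGENCE.md VER-A45, HINTZ-PLAN.md P24).
Audit context: `run/shared/lean/pub/pub-kerr/HINTZ-PLAN.md` P21, `GAPS.md` C-A13, `ADEP.md` §D.11.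

## References
* P. Hintz, arXiv:2606.27658v1 (2026) [key `HintzCD2026`; preprint]: Thm 1.1 (p. 3), (4.10)–(4.19), Lemma 4.6, Cor 4.7,
  Def 4.8, Thm 4.9 (pp. 38–41, CD l.2214–2429), App. A (pp. 95–127, CD l.3799–4450).
* P. Hintz, arXiv:2606.28253v2 (2026) [key `Hintz2026`; claim under review]: Thm 7.1 `ThmWCRec` and its proof
  (p. 136–137, H l.6820–6858), eq. (7.6) `EqWCRecBox0` (H l.6803–6816), eq. (7.8) `EqWCIndRoots` (H l.6837–6846).
-/

noncomputable section

open Matrix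

namespace Literature.Geometry.Lorentzian.Hintz2026.ConstraintDampingRoots

/-! ## 1. The printed operator (type-reduced, multiplied by `h`) and the three characteristic polynomials -/

/-- `h • N_{s l}(λ)`: the scalar-type-`l` indicial family of `ρ⁻²□̂^{𝒞_{v,e,h}}(0)` (CD (4.19) with the `q`-table of
Cor 4.7 = Hintz (7.6), type-reduced as in CD App. A.3, l.4023–4028: `Δ̸ ↦ diag(L,L,L−1)`, `d̸ ↦ 1`, `δ̸ ↦ L`),
multiplied through by `h` so that all entries are polynomial; `L` stands for `l(l+1)`.
[cite: HintzCD2026, Cor 4.7 + (4.19) + App. A.3, TeX l.2375-2404 and l.4023-4028 (transcription; preprint)] -/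
def Msl (e h v L lam : ℝ) : Matrix (Fin 3) (Fin 3) ℝ :=
  !![h * (-lam ^ 2 + lam + L + 1) + ((1 - 3 * v + e + e * v) * lam + (-1 + 3 * v + e + e * v)),
     -h + (-(1 - e) * (1 - v) * lam + (1 + e) * (1 - v)),
     -h * L + (1 - v) * L;
     -h + ((1 - e) * (1 + v) * lam - (1 + e) * (1 + v)),
     h * (-lam ^ 2 + lam + L + 1) + ((-1 - 3 * v - e + e * v) * lam + (1 + 3 * v - e + e * v)),
     h * L + (1 + v) * L;
     -2 * h + -2 * e * (1 + v),
     2 * h + -2 * e * (1 - v),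
     h * (-lam ^ 2 + lam + (L - 1) + 1) + (-2 * v * lam + 4 * v)]

/-- `h • N_{s0}(λ)`: the scalar-type-`0` indicial family (upper `2 × 2` block, `Δ̸ ↦ 0`; CD App. A.2, l.3986–3990),
multiplied by `h`. [cite: HintzCD2026, App. A.2, TeX l.3986-3990 (transcription; preprint)] -/
def Ms0 (e h v lam : ℝ) : Matrix (Fin 2) (Fin 2) ℝ :=
  !![h * (-lam ^ 2 + lam + 1) + ((1 - 3 * v + e + e * v) * lam + (-1 + 3 * v + e + e * v)),
     -h + (-(1 - e) * (1 - v) * lam + (1 + e) * (1 - v));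
     -h + ((1 - e) * (1 + v) * lam - (1 + e) * (1 + v)),
     h * (-lam ^ 2 + lam + 1) + ((-1 - 3 * v - e + e * v) * lam + (1 + 3 * v - e + e * v))]

/-- `h N_{v l}(λ)`: the vector-type-`l` indicial family (a scalar; CD App. A.1, l.3814–3817), multiplied by `h`.
[cite: HintzCD2026, App. A.1, TeX l.3814-3817 (transcription; preprint)] -/
def Mv (h v L lam : ℝ) : ℝ := h * (-lam ^ 2 + lam + (L - 1) + 1) + (-2 * v * lam + 4 * v)

/-- The printed vector-type polynomial `p_v(h,l,λ) = −hλ² + (h−2v)λ + (l(l+1)h + 4v)` (CD l.3816), `L = l(l+1)`.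
[cite: HintzCD2026, App. A.1, TeX l.3816 (transcription; preprint)] -/
def pV (h v L lam : ℝ) : ℝ := -h * lam ^ 2 + (h - 2 * v) * lam + (L * h + 4 * v)

/-- The printed scalar-type-`0` cubic `p_{s0}(e,h,λ)` (CD l.3991–3994).
[cite: HintzCD2026, App. A.2, TeX l.3991-3994 (transcription; preprint)] -/
def pS0 (e h v lam : ℝ) : ℝ :=
  h ^ 2 * lam ^ 3 + (2 * (3 - e) * h * v - h ^ 2) * lam ^ 2
    + (4 * (2 - e) * v ^ 2 - 4 * e - 2 * (e + 3) * h * v - 2 * h ^ 2) * lam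
    - 4 * ((2 + e) * v ^ 2 + e + h * v)

/-- Coefficient of `h²λ⁵` in the printed sextic (CD eq. `EqMsPoly`, l.4033). [cite: HintzCD2026, App. A.3 (EqMsPoly), TeX l.4033] -/
def c5 (e h v : ℝ) : ℝ := 2 * (4 - e) * v - 3 * h

/-- Coefficient of `hλ⁴` in `EqMsPoly` (CD l.4034). [cite: HintzCD2026, App. A.3 (EqMsPoly), TeX l.4034] -/
def c4 (e h v L : ℝ) : ℝ := 4 * (5 - 2 * e) * v ^ 2 - 4 * e - 2 * (13 - e) * h * v - (3 * L - 1) * h ^ 2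

/-- Coefficient of `λ³` in `EqMsPoly` (CD l.4035–4036). [cite: HintzCD2026, App. A.3 (EqMsPoly), TeX l.4035-4036] -/
def c3 (e h v L : ℝ) : ℝ :=
  8 * ((2 - e) * v ^ 2 - e) * v - 4 * ((18 - 3 * e) * v ^ 2 - e) * h
    + 2 * ((10 + e) * v + 2 * (e - 4) * v * L) * h ^ 2 + 3 * (1 + 2 * L) * h ^ 3

/-- Coefficient of `λ²` in `EqMsPoly` (CD l.4037–4038; `3(l²+l−1)l(l+1) − 2 = 3(L−1)L − 2`).
[cite: HintzCD2026, App. A.3 (EqMsPoly), TeX l.4037-4038] -/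
def c2 (e h v L : ℝ) : ℝ :=
  -16 * v * ((4 - e) * v ^ 2 - e) + 4 * ((19 + 2 * e) * v ^ 2 - ((5 - e) * v ^ 2 - 2 * e) * L + e) * h
    + 2 * (5 - e + 2 * (8 - e) * L) * v * h ^ 2 + (3 * (L - 1) * L - 2) * h ^ 3

/-- Coefficient of `λ` in `EqMsPoly` (CD l.4039–4041; `l²(l+1)² = L²`). [cite: HintzCD2026, App. A.3 (EqMsPoly), TeX l.4039-4041] -/
def c1 (e h v L : ℝ) : ℝ :=
  8 * ((10 + e) * v ^ 2 + e * (1 + (1 - v ^ 2) * L)) * v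
    + 4 * ((11 * L - 2) * v ^ 2 - e * (1 + 3 * v ^ 2 + (1 + 2 * v ^ 2) * L)) * h
    - 2 * (6 + 8 * L - (4 - e) * L ^ 2) * v * h ^ 2 - 3 * L ^ 2 * h ^ 3

/-- Constant coefficient of `EqMsPoly` (CD l.4042–4044; `l(l+1)(l²+l−1) = L(L−1)`, `(l−1)l²(l+1)²(l+2) = L²(L−2)`).
[cite: HintzCD2026, App. A.3 (EqMsPoly), TeX l.4042-4044] -/
def c0 (e h v L : ℝ) : ℝ :=
  -8 * v * (4 * v ^ 2 + e * (2 * (1 + v ^ 2) + (1 - v ^ 2) * L))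
    - 4 * (2 * (2 + 3 * L) * v ^ 2 + e * (1 - v ^ 2) * L * (L - 1)) * h
    - 2 * (2 + (3 - e) * L) * L * v * h ^ 2 - L ^ 2 * (L - 2) * h ^ 3

/-- The printed scalar-type-`l` sextic `p(e,h,l,λ) := −h³ det N_{s l}(λ)` of CD App. A.3, eq. (A.13) `EqMsPoly` (l.4029–4046),
as a function of `L = l(l+1)` (the printed `l`-polynomials depend on `l` only through `L`, see `c2`, `c1`, `c0`).
[cite: HintzCD2026, App. A.3 (EqMsPoly), TeX l.4029-4046 (transcription; preprint)] -/
def pS (e h v L lam : ℝ) : ℝ :=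
  h ^ 3 * lam ^ 6 + c5 e h v * h ^ 2 * lam ^ 5 + c4 e h v L * h * lam ^ 4 + c3 e h v L * lam ^ 3
    + c2 e h v L * lam ^ 2 + c1 e h v L * lam + c0 e h v L

/-- **The printed sextic IS the determinant** (CD l.4032: "`p(e,h,l,λ) := −h³ det N_{s l}(λ)`"): for all real
`e, h, v, L, λ`, `det (h•N_{s l}(λ)) = −p(e,h,l,λ)`.  [cite: HintzCD2026, App. A.3 eq. EqMsPoly, TeX l.4029-4046] -/
theorem det_Msl (e h v L lam : ℝ) : (Msl e h v L lam).det = -pS e h v L lam := by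
  rw [pS, c5, c4, c3, c2, c1, c0]
  simp [Msl, Matrix.det_fin_three]
  ring

/-- **Scalar type 0** (CD l.3990–3994: "`N_{s0}(1)` is singular for any choice of `e,v,h`, so `λ = 1` is always a scalar
type `0` indicial root. We shall thus study the roots of `p_{s0}(e,h,λ) = h²(λ−1)⁻¹ det N_{s0}(λ)`"):
`det (h•N_{s0}(λ)) = (λ−1)·p_{s0}(e,h,λ)` for all real parameters.  [cite: HintzCD2026, App. A.2, TeX l.3990-3994] -/
theorem det_Ms0 (e h v lam : ℝ) : (Ms0 e h v lam).det = (lam - 1) * pS0 e h v lam := by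
  rw [Ms0, Matrix.det_fin_two_of, pS0]
  ring

/-- **Vector type** (CD l.3814–3817): `h N_{v l}(λ) = p_v(h,l,λ)`. [cite: HintzCD2026, App. A.1, TeX l.3814-3817] -/
theorem Mv_eq (h v L lam : ℝ) : Mv h v L lam = pV h v L lam := by
  rw [Mv, pV]; ring

/-! ## 2. The root `λ = 1` and its simplicity (Thm 4.9(2); Hintz (7.8) lists `1` under `s0` and `s1` only) -/

/-- `λ = 1` is always a scalar-type-`0` root: `det(h•N_{s0}(1)) = 0`. [cite: HintzCD2026, App. A.2, TeX l.3990] -/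
theorem det_Ms0_one (e h v : ℝ) : (Ms0 e h v 1).det = 0 := by
  rw [det_Ms0]; ring

/-- `p(e,h,1,1) = 0` for all `e, h` (CD l.4177: "For `l = 1`, we in fact have `p(e,h,1,1) = 0` for all `e,h`"), i.e.
`λ = 1` is always a scalar-type-`1` root (`L = 2`). [cite: HintzCD2026, App. A.3 (P1), TeX l.4177] -/
theorem pS_L2_one (e h v : ℝ) : pS e h v 2 1 = 0 := by
  simp only [pS, c5, c4, c3, c2, c1, c0]; ring

/-- `p(e,0,l,1) = 0` for all `e, l` (CD l.4177: "`λ = λ₀(e,0,l) := 1` is always a root" of the cubic `p(e,0,l,·)`).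
[cite: HintzCD2026, App. A.3 (P1), TeX l.4177] -/
theorem pS_h0_one (e v L : ℝ) : pS e 0 v L 1 = 0 := by
  simp only [pS, c5, c4, c3, c2, c1, c0]; ring

/-- The quintic cofactor of `λ − 1` in `p(e,h,1,·)` (our factorisation; not printed). [folklore] -/
def Q5 (e h v lam : ℝ) : ℝ :=
  -2*e*h^2*lam^4*v + 10*e*h^2*lam^2*v - 8*e*h^2*v - 8*e*h*lam^3*v^2 - 4*e*h*lam^3 + 4*e*h*lam^2*v^2
  + 20*e*h*lam*v^2 + 20*e*h*lam - 8*e*h*v^2 + 8*e*h - 8*e*lam^2*v^3 - 8*e*lam^2*v + 8*e*lam*v^3 + 8*e*lam*v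
  + 32*e*v + h^3*lam^5 - 2*h^3*lam^4 - 7*h^3*lam^3 + 8*h^3*lam^2 + 12*h^3*lam + 8*h^2*lam^4*v - 18*h^2*lam^3*v
  - 30*h^2*lam^2*v + 44*h^2*lam*v + 32*h^2*v + 20*h*lam^3*v^2 - 52*h*lam^2*v^2 - 16*h*lam*v^2 + 64*h*v^2
  + 16*lam^2*v^3 - 48*lam*v^3 + 32*v^3

/-- `p(e,h,1,λ) = (λ − 1)·Q₅(e,h,λ)` (`L = 2`). [folklore] -/
theorem pS_L2_factor (e h v lam : ℝ) : pS e h v 2 lam = (lam - 1) * Q5 e h v lam := by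
  simp only [pS, c5, c4, c3, c2, c1, c0, Q5]; ring

/-- `Q₅(e,h,1) = 4(3h³ + 9h²v + 4hv² + 2ehv² + 6eh + 8ev)` (`= 32ev` at `h = 0`, the value `8v·p₁(e,1,1)` of regime (P1)).
[folklore] -/
theorem Q5_one (e h v : ℝ) :
    Q5 e h v 1 = 4 * (3 * h ^ 3 + 9 * h ^ 2 * v + 4 * h * v ^ 2 + 2 * e * h * v ^ 2 + 6 * e * h + 8 * e * v) := by
  simp only [Q5]; ring

/-- **Thm 4.9(2), "a scalar type 1 root (also of order 1)":** for `e, h, v > 0`, `Q₅(e,h,1) > 0`, so `λ = 1` is a SIMPLE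
root of `p(e,h,1,·)`. [cite: HintzCD2026, Thm 4.9(2), TeX l.2423] -/
theorem Q5_one_pos {e h v : ℝ} (he : 0 < e) (hh : 0 < h) (hv : 0 < v) : 0 < Q5 e h v 1 := by
  rw [Q5_one]; positivity

/-- `p_{s0}(e,h,1) = −(4(1+e)hv + 8ev² + 8e + 2h²)`. [folklore] -/
theorem pS0_one (e h v : ℝ) : pS0 e h v 1 = -(4 * (1 + e) * h * v + 8 * e * v ^ 2 + 8 * e + 2 * h ^ 2) := by
  simp only [pS0]; ring

/-- **Thm 4.9(2), scalar type 0 root `1` "of order 1":** for `e, h, v > 0`, `p_{s0}(e,h,1) < 0 ≠ 0`, so `λ = 1` is a SIMPLE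
root of `det N_{s0} = h⁻²(λ−1)p_{s0}`. [cite: HintzCD2026, Thm 4.9(2), TeX l.2423] -/
theorem pS0_one_neg {e h v : ℝ} (he : 0 < e) (hh : 0 < h) (hv : 0 < v) : pS0 e h v 1 < 0 := by
  rw [pS0_one]
  have : 0 < 4 * (1 + e) * h * v + 8 * e * v ^ 2 + 8 * e + 2 * h ^ 2 := by positivity
  linarith

/-! ## 3. Vector type, complete with an explicit threshold (CD App. A.1; Hintz (7.8) last line) -/

/-- `l = 1` (`L = 2`): `p_v(h,1,λ) = −(λ − 2)(hλ + h + 2v)`, roots `2` and `−2v/h − 1` (CD l.3819; Hintz (7.8):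
"`v1`: `−1 − 2v^𝓒γ^𝓒, 2`", H l.6845). [cite: HintzCD2026, App. A.1, TeX l.3819] -/
theorem pV_L2 (h v lam : ℝ) : pV h v 2 lam = -((lam - 2) * (h * lam + h + 2 * v)) := by
  rw [pV]; ring

/-- `p_v(0,l,λ) = −2v(λ−2)` (CD l.3839). [cite: HintzCD2026, App. A.1, TeX l.3839] -/
theorem pV_h0 (v L lam : ℝ) : pV 0 v L lam = -(2 * v * (lam - 2)) := by
  rw [pV]; ring

/-- `p_v(h,l,1) = 2v + Lh` (`> 0`: `1` is never a vector-type root). [folklore] -/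
theorem pV_one (h v L : ℝ) : pV h v L 1 = 2 * v + L * h := by rw [pV]; ring

/-- `p_v(h,l,2) = (L−2)h` (`≥ 0`, `= 0` iff `l = 1`). [folklore] -/
theorem pV_two (h v L : ℝ) : pV h v L 2 = (L - 2) * h := by rw [pV]; ring

/-- `p_v(h,l,−C) = 2v(C+2) + h(L − C² − C)`. [folklore] -/
theorem pV_neg (h v L C : ℝ) : pV h v L (-C) = 2 * v * (C + 2) + h * (L - C ^ 2 - C) := by rw [pV]; ring

/-- Chord identity of the concave quadratic `p_v` on `[−C, 2]`:
`(2+C)p_v(x) = (2−x)p_v(−C) + (x+C)p_v(2) + h(2−x)(x+C)(2+C)`. [folklore] -/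
theorem pV_chord (h v L C x : ℝ) :
    (2 + C) * pV h v L x = (2 - x) * pV h v L (-C) + (x + C) * pV h v L 2 + h * (2 - x) * (x + C) * (2 + C) := by
  simp only [pV]; ring

/-- `p_v(−C) > 0` under the explicit threshold `h(C−1) < 2v` (worst case `l = 1`:
`p_v(h,1,−C) = (C+2)(2v − h(C−1))`). [folklore] -/
theorem pV_neg_pos {h v L C : ℝ} (hh : 0 < h) (hL : 2 ≤ L) (hC : 0 ≤ C) (hth : h * (C - 1) < 2 * v) :
    0 < pV h v L (-C) := by
  rw [pV_neg]
  have h1 : h * (2 - C ^ 2 - C) ≤ h * (L - C ^ 2 - C) := by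
    apply mul_le_mul_of_nonneg_left _ hh.le; linarith
  have h2 : 2 * v * (C + 2) + h * (2 - C ^ 2 - C) = (C + 2) * (2 * v - h * (C - 1)) := by ring
  have h3 : 0 < (C + 2) * (2 * v - h * (C - 1)) := by
    apply mul_pos <;> linarith
  linarith

/-- **Vector type, Thm 4.9(1): no root with real part in `[−C, 1)` … in fact `p_v > 0` on `[−C, 2)`** for `h, v > 0`,
`L ≥ 2` (`l ≥ 1`), `C ≥ 0`, `h(C−1) < 2v`. [cite: HintzCD2026, Thm 4.9(1) + App. A.1, TeX l.2422 and l.3811-3979] -/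
theorem pV_pos_of_mem {h v L C x : ℝ} (hh : 0 < h) (hL : 2 ≤ L) (hC : 0 ≤ C)
    (hth : h * (C - 1) < 2 * v) (hx1 : -C ≤ x) (hx2 : x < 2) : 0 < pV h v L x := by
  have hA := pV_neg_pos hh hL hC hth
  have hB : 0 ≤ pV h v L 2 := by rw [pV_two]; nlinarith
  have hc := pV_chord h v L C x
  have h3 : 0 ≤ h * (2 - x) * (x + C) * (2 + C) := by
    have : 0 ≤ (2 - x) * (x + C) * (2 + C) := by
      apply mul_nonneg (mul_nonneg (by linarith) (by linarith)) (by linarith)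
    nlinarith
  have h4 : 0 < (2 - x) * pV h v L (-C) := mul_pos (by linarith) hA
  have h5 : 0 ≤ (x + C) * pV h v L 2 := mul_nonneg (by linarith) hB
  nlinarith

/-- Discriminant of `p_v`: `D = (h−2v)² + 4h(Lh+4v)`. [folklore] -/
def discV (h v L : ℝ) : ℝ := (h - 2 * v) ^ 2 + 4 * h * (L * h + 4 * v)

/-- `λ₋ := ((h−2v) − √D)/(2h)`. [folklore] -/
def lamMinus (h v L : ℝ) : ℝ := ((h - 2 * v) - Real.sqrt (discV h v L)) / (2 * h)

/-- `λ₊ := ((h−2v) + √D)/(2h)`. [folklore] -/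
def lamPlus (h v L : ℝ) : ℝ := ((h - 2 * v) + Real.sqrt (discV h v L)) / (2 * h)

/-- `D > 0` for `h, v > 0`, `L ≥ 0`. [folklore] -/
theorem discV_pos {h v L : ℝ} (hh : 0 < h) (hv : 0 < v) (hL : 0 ≤ L) : 0 < discV h v L := by
  unfold discV
  have : 0 < 4 * h * (L * h + 4 * v) := by positivity
  nlinarith [sq_nonneg (h - 2 * v)]

/-- `p_v(x) = −h(x − λ₋)(x − λ₊)` (`h > 0`, `v > 0`, `L ≥ 0`). [folklore] -/
theorem pV_factor {h v L : ℝ} (hh : 0 < h) (hv : 0 < v) (hL : 0 ≤ L) (x : ℝ) :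
    pV h v L x = -h * (x - lamMinus h v L) * (x - lamPlus h v L) := by
  have hD := (discV_pos hh hv hL).le
  have hs : Real.sqrt (discV h v L) ^ 2 = discV h v L := Real.sq_sqrt hD
  have hh0 : h ≠ 0 := hh.ne'
  have e1 : -h * (x - lamMinus h v L) * (x - lamPlus h v L) =
      -h * x ^ 2 + (h - 2 * v) * x - ((h - 2 * v) ^ 2 - Real.sqrt (discV h v L) ^ 2) / (4 * h) := by
    unfold lamMinus lamPlus; field_simp; ring
  rw [e1, hs, discV, pV]
  field_simp
  ring

/-- Complex version of `p_v`. [folklore] -/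
def pVC (h v L : ℝ) (z : ℂ) : ℂ := -(h : ℂ) * z ^ 2 + ((h : ℂ) - 2 * v) * z + ((L : ℂ) * h + 4 * v)

/-- `p_v` over `ℂ` restricted to real arguments. [folklore] -/
theorem pVC_ofReal (h v L x : ℝ) : pVC h v L (x : ℂ) = ((pV h v L x : ℝ) : ℂ) := by
  unfold pVC pV; push_cast; ring

/-- `p_v(z) = −h(z − λ₋)(z − λ₊)` over `ℂ`. [folklore] -/
theorem pVC_factor {h v L : ℝ} (hh : 0 < h) (hv : 0 < v) (hL : 0 ≤ L) (z : ℂ) :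
    pVC h v L z = -(h : ℂ) * (z - lamMinus h v L) * (z - lamPlus h v L) := by
  have hD := (discV_pos hh hv hL).le
  have hs : Real.sqrt (discV h v L) ^ 2 = discV h v L := Real.sq_sqrt hD
  -- sum and product of the roots
  have hsum : lamMinus h v L + lamPlus h v L = (h - 2 * v) / h := by
    have hh0 : h ≠ 0 := hh.ne'
    unfold lamMinus lamPlus; field_simp; ring
  have hh0' : h ≠ 0 := hh.ne'
  have hprod : lamMinus h v L * lamPlus h v L = -(L * h + 4 * v) / h := by
    have e1 : lamMinus h v L * lamPlus h v L =
        ((h - 2 * v) ^ 2 - Real.sqrt (discV h v L) ^ 2) / (4 * h ^ 2) := by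
      unfold lamMinus lamPlus; field_simp; ring
    rw [e1, hs, discV]; field_simp; ring
  have key : -(h : ℂ) * (z - lamMinus h v L) * (z - lamPlus h v L) =
      -(h : ℂ) * z ^ 2 + (h : ℂ) * ((lamMinus h v L + lamPlus h v L : ℝ) : ℂ) * z
        - (h : ℂ) * ((lamMinus h v L * lamPlus h v L : ℝ) : ℂ) := by
    push_cast; ring
  rw [key, hsum, hprod, pVC]
  have hh0 : (h : ℂ) ≠ 0 := by exact_mod_cast hh.ne'
  push_cast
  field_simp
  ring

/-- `λ₋` is a root of `p_v`. [folklore] -/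
theorem pV_lamMinus {h v L : ℝ} (hh : 0 < h) (hv : 0 < v) (hL : 0 ≤ L) : pV h v L (lamMinus h v L) = 0 := by
  rw [pV_factor hh hv hL]; ring

/-- `λ₊` is a root of `p_v`. [folklore] -/
theorem pV_lamPlus {h v L : ℝ} (hh : 0 < h) (hv : 0 < v) (hL : 0 ≤ L) : pV h v L (lamPlus h v L) = 0 := by
  rw [pV_factor hh hv hL]; ring

/-- `λ₋ < 1/2` (`h, v > 0`). [folklore] -/
theorem lamMinus_lt_half {h v L : ℝ} (hh : 0 < h) (hv : 0 < v) : lamMinus h v L < 1 / 2 := by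
  unfold lamMinus
  have hs : 0 ≤ Real.sqrt (discV h v L) := Real.sqrt_nonneg _
  rw [div_lt_iff₀ (by linarith)]
  nlinarith

/-- `λ₊ > 0` (`√D > |h − 2v|`). [folklore] -/
theorem lamPlus_pos {h v L : ℝ} (hh : 0 < h) (hv : 0 < v) (hL : 0 ≤ L) : 0 < lamPlus h v L := by
  unfold lamPlus
  apply div_pos _ (by linarith)
  -- `√D > |h − 2v|`
  have hlt : (h - 2 * v) ^ 2 < discV h v L := by
    unfold discV
    have : 0 < 4 * h * (L * h + 4 * v) := by positivity
    linarith
  have h1 : |h - 2 * v| < Real.sqrt (discV h v L) := by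
    rw [← Real.sqrt_sq_eq_abs]
    exact Real.sqrt_lt_sqrt (sq_nonneg _) hlt
  have h2 : -(h - 2 * v) ≤ |h - 2 * v| := neg_le_abs _
  linarith

/-- **Vector type, the large negative root:** `λ₋ < −C` (`h(C−1) < 2v`, `L ≥ 2`, `C ≥ 0`).
[cite: HintzCD2026, Thm 4.9(1),(3) vector type + App. A.1, TeX l.2422-2424 and l.3977-3979] -/
theorem lamMinus_lt {h v L C : ℝ} (hh : 0 < h) (hv : 0 < v) (hL : 2 ≤ L) (hC : 0 ≤ C)
    (hth : h * (C - 1) < 2 * v) : lamMinus h v L < -C := by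
  by_contra hcon
  rw [not_lt] at hcon
  have h1 := lamMinus_lt_half hh hv (L := L)
  have h2 := pV_pos_of_mem hh hL hC hth hcon (by linarith)
  rw [pV_lamMinus hh hv (by linarith)] at h2
  exact lt_irrefl _ h2

/-- **Vector type, the positive root:** `2 ≤ λ₊` (`h(C−1) < 2v` for some `C ≥ 0`, e.g. `C = 0`; `L ≥ 2`).
[cite: HintzCD2026, Thm 4.9(1),(3) vector type + App. A.1, TeX l.2422-2424 and l.3977-3979] -/
theorem two_le_lamPlus {h v L : ℝ} (hh : 0 < h) (hv : 0 < v) (hL : 2 ≤ L) : 2 ≤ lamPlus h v L := by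
  by_contra hcon
  rw [not_le] at hcon
  have h1 := lamPlus_pos hh hv (by linarith : (0:ℝ) ≤ L)
  have h2 := pV_pos_of_mem (v := v) (C := 0) hh hL le_rfl (by nlinarith) (by linarith) hcon
  rw [pV_lamPlus hh hv (by linarith)] at h2
  exact lt_irrefl _ h2

/-- **[CD] Thm 4.9 (1)–(3) for VECTOR TYPE, every `l ≥ 1`, explicit threshold; = Hintz (7.8) "`v l` roots, `l ≥ 1`:
`λ^𝓒_{v l,≪}, λ^𝓒_{v l,+}`".**  For `h, v > 0`, `L = l(l+1) ≥ 2`, `C ≥ 0` with `h(C−1) < 2v`: every complex root of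
`p_v(h,l,·)` is real and equals `λ₋ < −C` or `λ₊ ≥ 2`; both are roots.  (No condition on `e`; CD's proof, l.3977–3979:
"for all `h ≤ h₀`, one of the two roots … is `> 1` and the other is `< −C₀` for all `l ∈ ℕ`".)
[cite: HintzCD2026, Thm 4.9 + App. A.1, TeX l.2419-2429 and l.3977-3979; Hintz2026, eq. (7.8), TeX l.6845] -/
theorem vectorType_roots {h v L C : ℝ} (hh : 0 < h) (hv : 0 < v) (hL : 2 ≤ L) (hC : 0 ≤ C)
    (hth : h * (C - 1) < 2 * v) :
    lamMinus h v L < -C ∧ 2 ≤ lamPlus h v L ∧ pV h v L (lamMinus h v L) = 0 ∧ pV h v L (lamPlus h v L) = 0 ∧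
      ∀ z : ℂ, pVC h v L z = 0 → (z = (lamMinus h v L : ℂ) ∨ z = (lamPlus h v L : ℂ)) := by
  have hL0 : (0:ℝ) ≤ L := by linarith
  refine ⟨lamMinus_lt hh hv hL hC hth, two_le_lamPlus hh hv hL, pV_lamMinus hh hv hL0, pV_lamPlus hh hv hL0, ?_⟩
  intro z hz
  rw [pVC_factor hh hv hL0] at hz
  have hh0 : (h : ℂ) ≠ 0 := by exact_mod_cast hh.ne'
  rcases mul_eq_zero.1 hz with hz1 | hz2
  · rcases mul_eq_zero.1 hz1 with hz3 | hz4
    · exact absurd (neg_eq_zero.1 hz3) hh0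
    · left; exact sub_eq_zero.1 hz4
  · right; exact sub_eq_zero.1 hz2

/-- **Thm 4.9(4) for vector type:** `hL ≤ hλ₊² + 2vλ₊`, so `λ₊ ≥ √(L + v²/h²) − v/h → ∞` as `l → ∞` (CD l.3979:
"the roots diverge to `±∞` as `l → ∞`"). [cite: HintzCD2026, Thm 4.9(4) + App. A.1, TeX l.2425 and l.3979] -/
theorem hL_le {h v L : ℝ} (hh : 0 < h) (hv : 0 < v) (hL : 0 ≤ L) :
    h * L ≤ h * lamPlus h v L ^ 2 + 2 * v * lamPlus h v L := by
  have h0 := pV_lamPlus hh hv hL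
  have hp := lamPlus_pos hh hv hL
  rw [pV] at h0
  nlinarith

/-! ## 4. Scalar type 0, complete with explicit thresholds (CD App. A.2; Hintz (7.8) first line) -/

/-- `h·p_{s0}(e,h,−3v/h) = 3v³ + hv² + 2h²v + e(12v − 6v³ + 2hv² − 4h)` (`h ≠ 0`): the probe between the printed
leading orders `−4v/h` and `−2v/h` of the two large negative roots (CD l.4010–4013). [folklore] -/
theorem pS0_mid (e v : ℝ) {h : ℝ} (hh : h ≠ 0) :
    h * pS0 e h v (-(3 * v) / h) =
      3 * v ^ 3 + h * v ^ 2 + 2 * h ^ 2 * v + e * (12 * v - 6 * v ^ 3 + 2 * h * v ^ 2 - 4 * h) := by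
  rw [pS0]; field_simp; ring

/-- `p_{s0}(−3v/h) > 0` for `0 < v < 1`, `0 < e`, `0 < h ≤ 3v/2`. [folklore] -/
theorem pS0_mid_pos {e h v : ℝ} (he : 0 < e) (hh : 0 < h) (hv : 0 < v) (hv1 : v < 1) (hhv : 2 * h ≤ 3 * v) :
    0 < pS0 e h v (-(3 * v) / h) := by
  have key := pS0_mid e v hh.ne'
  have hpos : 0 < 3 * v ^ 3 + h * v ^ 2 + 2 * h ^ 2 * v + e * (12 * v - 6 * v ^ 3 + 2 * h * v ^ 2 - 4 * h) := by
    have h1 : 0 < e * (12 * v - 6 * v ^ 3 + 2 * h * v ^ 2 - 4 * h) := by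
      apply mul_pos he
      have : v ^ 3 < v := by nlinarith
      nlinarith
    positivity
  have h2 : 0 < h * pS0 e h v (-(3 * v) / h) := by rw [key]; exact hpos
  exact (mul_pos_iff_of_pos_left hh).1 h2

/-- `p_{s0}(−(10v/h + 3)) < 0` for `e ≤ v² < 1`, `h, v > 0` (a point to the left of both large negative roots).
[folklore] -/
theorem pS0_left_neg {e h v : ℝ} (he : 0 < e) (hev : e ≤ v ^ 2) (hh : 0 < h) (hv : 0 < v) (hv1 : v < 1) :
    pS0 e h v (-(10 * v / h + 3)) < 0 := by
  set M : ℝ := 10 * v / h + 3 with hM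
  have hhM : h * M = 10 * v + 3 * h := by rw [hM]; field_simp; try ring
  have hM2 : 2 ≤ M := by
    have : 0 < 10 * v / h := by positivity
    linarith
  have he1 : e < 1 := by nlinarith
  have hA : 0 ≤ 4 * (2 - e) * v ^ 2 - 4 * e := by nlinarith
  -- p(−M) = −h²M³ + (2(3−e)hv − h²)M² − (A − 2(e+3)hv − 2h²)M − 4((2+e)v² + e + hv)
  have expand : pS0 e h v (-M) =
      -(h ^ 2 * M ^ 3) + (2 * (3 - e) * h * v - h ^ 2) * M ^ 2
        - (4 * (2 - e) * v ^ 2 - 4 * e - 2 * (e + 3) * h * v - 2 * h ^ 2) * M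
        - 4 * ((2 + e) * v ^ 2 + e + h * v) := by rw [pS0]; ring
  rw [expand]
  -- the positive part 2(3−e)hvM² + 2(e+3)hvM + 2h²M ≤ 6hvM² + 8hvM + 2h²M < h²M³ = hM·hM² ≥ (10v+3h)... M²
  have h1 : 2 * (3 - e) * h * v * M ^ 2 ≤ 6 * h * v * M ^ 2 := by
    have : 0 ≤ e * (h * v * M ^ 2) := by positivity
    nlinarith [this]
  have h2 : 2 * (e + 3) * h * v * M ≤ 8 * h * v * M := by
    have : 0 ≤ (1 - e) * (h * v * M) := mul_nonneg (sub_nonneg.2 he1.le) (by positivity)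
    nlinarith [this]
  have h3 : 6 * h * v * M ^ 2 + 8 * h * v * M + 2 * h ^ 2 * M < h ^ 2 * M ^ 3 := by
    have e3 : h ^ 2 * M ^ 3 = (10 * v + 3 * h) * (h * M ^ 2) := by
      have : h ^ 2 * M ^ 3 = (h * M) * (h * M ^ 2) := by ring
      rw [this, hhM]
    rw [e3]
    have hp : 0 < h * M ^ 2 := by positivity
    nlinarith [mul_pos hh hv, mul_pos (mul_pos hh hv) (by linarith : (0:ℝ) < M)]
  have h4 : 0 ≤ (4 * (2 - e) * v ^ 2 - 4 * e) * M := mul_nonneg hA (by linarith)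
  have h5 : 0 < 4 * ((2 + e) * v ^ 2 + e + h * v) := by positivity
  nlinarith

/-- `p_{s0}(5/(1−v²)) > 0` for `0 < v < 1`, `0 < e ≤ v²`, `0 < h` (a point to the right of the positive root; CD's
leading order `λ(e,0) = ((2+e)v²+e)/((2−e)v²−e)`, l.3998). [folklore] -/
theorem pS0_right_pos {e h v : ℝ} (he : 0 < e) (hev : e ≤ v ^ 2) (hh : 0 < h) (hv : 0 < v) (hv1 : v < 1) :
    0 < pS0 e h v (5 / (1 - v ^ 2)) := by
  set K : ℝ := 5 / (1 - v ^ 2) with hK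
  have hv2 : 0 < 1 - v ^ 2 := by nlinarith
  have hK5 : 5 ≤ K := by
    rw [hK, le_div_iff₀ hv2]; nlinarith
  have hKv : (1 - v ^ 2) * K = 5 := by rw [hK]; field_simp
  have expand : pS0 e h v K =
      h ^ 2 * K * (K ^ 2 - K - 2) + 2 * h * v * ((3 - e) * K ^ 2 - (e + 3) * K - 2)
        + ((4 * (2 - e) * v ^ 2 - 4 * e) * K - 4 * (2 + e) * v ^ 2 - 4 * e) := by rw [pS0]; ring
  rw [expand]
  have he1 : e < 1 := by nlinarith
  have t1 : 0 ≤ h ^ 2 * K * (K ^ 2 - K - 2) := by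
    have : 0 ≤ K ^ 2 - K - 2 := by nlinarith
    positivity
  have t2 : 0 < 2 * h * v * ((3 - e) * K ^ 2 - (e + 3) * K - 2) := by
    have : 0 < (3 - e) * K ^ 2 - (e + 3) * K - 2 := by
      nlinarith [mul_pos (sub_pos.2 he1) (by positivity : (0:ℝ) < K ^ 2)]
    positivity
  -- (4(2−e)v² − 4e)K ≥ 4v²(1−v²)K = 20v² > 16v² ≥ 4(2+e)v² + 4e
  have t3a : 4 * v ^ 2 * (1 - v ^ 2) ≤ 4 * (2 - e) * v ^ 2 - 4 * e := by
    nlinarith [mul_nonneg (sub_nonneg.2 hev) (by positivity : (0:ℝ) ≤ 1 + v ^ 2)]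
  have t3b : 4 * v ^ 2 * (1 - v ^ 2) * K = 20 * v ^ 2 := by
    have : 4 * v ^ 2 * (1 - v ^ 2) * K = 4 * v ^ 2 * ((1 - v ^ 2) * K) := by ring
    rw [this, hKv]; ring
  have t3c : 4 * v ^ 2 * (1 - v ^ 2) * K ≤ (4 * (2 - e) * v ^ 2 - 4 * e) * K :=
    mul_le_mul_of_nonneg_right t3a (by linarith)
  have t3d : 4 * (2 + e) * v ^ 2 + 4 * e ≤ 16 * v ^ 2 := by
    have : e * v ^ 2 ≤ v ^ 2 := by nlinarith
    nlinarith
  have t2' : 0 < (3 - e) * K ^ 2 - (e + 3) * K - 2 := by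
    nlinarith [mul_pos (sub_pos.2 he1) (by positivity : (0:ℝ) < K ^ 2)]
  nlinarith

/-- **Scalar type 0: `p_{s0} < 0` on `[−C, 1]`** for `0 < v < 1`, `0 < e ≤ v²`, `C ≥ 0`, `0 < h` with
`4h(C+1)² ≤ v` (so no `s0` root other than the removed factor `λ = 1` has real part in `[−C, 1]`, cf. Thm 4.9(1)).
[cite: HintzCD2026, Thm 4.9(1) + App. A.2, TeX l.2422 and l.4016-4017] -/
theorem pS0_neg_on_Icc {e h v C x : ℝ} (he : 0 < e) (hev : e ≤ v ^ 2) (hh : 0 < h) (hv : 0 < v) (hv1 : v < 1)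
    (hC : 0 ≤ C) (hth : 4 * h * (C + 1) ^ 2 ≤ v) (hx1 : -C ≤ x) (hx2 : x ≤ 1) : pS0 e h v x < 0 := by
  have he1 : e < 1 := by nlinarith
  have hA : 0 ≤ 4 * (2 - e) * v ^ 2 - 4 * e := by nlinarith
  have hhv : h ≤ v / 4 := by
    have h1' : 1 ≤ (C + 1) ^ 2 := by nlinarith
    have h2' : 4 * h ≤ 4 * h * (C + 1) ^ 2 := by nlinarith
    linarith
  rcases le_or_gt 0 x with hx0 | hx0
  · -- x ∈ [0, 1]
    have expand : pS0 e h v x =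
        h ^ 2 * x ^ 2 * (x - 1) + 2 * h * v * x * ((3 - e) * x - (e + 3))
          + ((4 * (2 - e) * v ^ 2 - 4 * e) * x - 4 * (2 + e) * v ^ 2 - 4 * e) - 2 * h ^ 2 * x - 4 * h * v := by
      rw [pS0]; ring
    rw [expand]
    have t1 : h ^ 2 * x ^ 2 * (x - 1) ≤ 0 := by
      apply mul_nonpos_of_nonneg_of_nonpos (by positivity); linarith
    have t2 : 2 * h * v * x * ((3 - e) * x - (e + 3)) ≤ 0 := by
      apply mul_nonpos_of_nonneg_of_nonpos (by positivity); nlinarith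
    have t3 : (4 * (2 - e) * v ^ 2 - 4 * e) * x - 4 * (2 + e) * v ^ 2 - 4 * e < 0 := by
      have : (4 * (2 - e) * v ^ 2 - 4 * e) * x ≤ (4 * (2 - e) * v ^ 2 - 4 * e) * 1 :=
        mul_le_mul_of_nonneg_left hx2 hA
      nlinarith
    have t4 : 0 < 4 * h * v := by positivity
    have t5 : 0 ≤ 2 * h ^ 2 * x := by positivity
    linarith
  · -- x ∈ [−C, 0): put y = −x ∈ (0, C]
    obtain ⟨y, hxy⟩ : ∃ y : ℝ, x = -y := ⟨-x, by ring⟩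
    have hy0 : 0 < y := by linarith
    have hyC : y ≤ C := by linarith
    have expand : pS0 e h v x =
        -(h ^ 2 * y ^ 3) - h ^ 2 * y ^ 2 - (4 * (2 - e) * v ^ 2 - 4 * e) * y - 4 * e - 4 * h * v
          - 4 * (2 + e) * v ^ 2 + (2 * h ^ 2 * y + 2 * (3 - e) * h * v * y ^ 2 + 2 * (e + 3) * h * v * y) := by
      rw [hxy, pS0]; ring
    rw [expand]
    have t1 : 0 ≤ h ^ 2 * y ^ 3 := by positivity
    have t2 : 0 ≤ h ^ 2 * y ^ 2 := by positivity
    have t3 : 0 ≤ (4 * (2 - e) * v ^ 2 - 4 * e) * y := mul_nonneg hA hy0.le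
    -- positive part P ≤ 2h²C + 6hvC² + 8hvC ≤ 6hv(C+1)² ≤ (3/2)v·v/ ... < 8v²
    have p1 : 2 * (3 - e) * h * v * y ^ 2 ≤ 6 * h * v * C ^ 2 := by
      have hyc : y ^ 2 ≤ C ^ 2 := by nlinarith
      have i1 : 0 ≤ e * (h * v * y ^ 2) := by positivity
      have i2 : h * v * y ^ 2 ≤ h * v * C ^ 2 := mul_le_mul_of_nonneg_left hyc (by positivity)
      nlinarith [i1, i2]
    have p2 : 2 * (e + 3) * h * v * y ≤ 8 * h * v * C := by
      have i1 : 0 ≤ (1 - e) * (h * v * y) := mul_nonneg (sub_nonneg.2 he1.le) (by positivity)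
      have i2 : h * v * y ≤ h * v * C := mul_le_mul_of_nonneg_left hyC (by positivity)
      nlinarith [i1, i2]
    have p3 : 2 * h ^ 2 * y ≤ 2 * h ^ 2 * C := by nlinarith [sq_nonneg h]
    have p4 : 2 * h ^ 2 * C ≤ 4 * h * v * C := by nlinarith [mul_nonneg hh.le hC]
    have p5 : 6 * h * v * C ^ 2 + 8 * h * v * C + 4 * h * v * C ≤ 6 * h * v * (C + 1) ^ 2 := by
      nlinarith [mul_pos hh hv]
    have p6 : 6 * h * v * (C + 1) ^ 2 ≤ 3 / 2 * v ^ 2 := by nlinarith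
    have p7 : 8 * v ^ 2 ≤ 4 * (2 + e) * v ^ 2 := by nlinarith
    nlinarith

/-- The complex cubic `p_{s0}`. [folklore] -/
def pS0C (e h v : ℝ) (z : ℂ) : ℂ :=
  (h : ℂ) ^ 2 * z ^ 3 + (2 * (3 - (e : ℂ)) * h * v - (h : ℂ) ^ 2) * z ^ 2
    + (4 * (2 - (e : ℂ)) * v ^ 2 - 4 * e - 2 * ((e : ℂ) + 3) * h * v - 2 * (h : ℂ) ^ 2) * z
    - 4 * ((2 + (e : ℂ)) * v ^ 2 + e + h * v)

/-- `p_{s0}` over `ℂ` restricted to real arguments. [folklore] -/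
theorem pS0C_ofReal (e h v x : ℝ) : pS0C e h v (x : ℂ) = ((pS0 e h v x : ℝ) : ℂ) := by
  unfold pS0C pS0; push_cast; ring

/-- A cubic with three distinct real roots is their product: if `r₁, r₂, r₃` are pairwise distinct real roots of
`p_{s0}(e,h,·)` then `p_{s0}(z) = h²(z−r₁)(z−r₂)(z−r₃)` for every `z ∈ ℂ` (elementary: the difference is a quadratic
vanishing at three points). [folklore] -/
theorem pS0C_eq_prod {e h v r₁ r₂ r₃ : ℝ} (h12 : r₁ ≠ r₂) (h13 : r₁ ≠ r₃) (h23 : r₂ ≠ r₃)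
    (z1 : pS0 e h v r₁ = 0) (z2 : pS0 e h v r₂ = 0) (z3 : pS0 e h v r₃ = 0) (z : ℂ) :
    pS0C e h v z = (h : ℂ) ^ 2 * (z - r₁) * (z - r₂) * (z - r₃) := by
  set A : ℝ := (2 * (3 - e) * h * v - h ^ 2) + h ^ 2 * (r₁ + r₂ + r₃) with hA
  set B : ℝ := (4 * (2 - e) * v ^ 2 - 4 * e - 2 * (e + 3) * h * v - 2 * h ^ 2)
    - h ^ 2 * (r₁ * r₂ + r₁ * r₃ + r₂ * r₃) with hB
  set Cc : ℝ := -(4 * ((2 + e) * v ^ 2 + e + h * v)) + h ^ 2 * (r₁ * r₂ * r₃) with hC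
  have key : ∀ x : ℝ, pS0 e h v x - h ^ 2 * (x - r₁) * (x - r₂) * (x - r₃) = A * x ^ 2 + B * x + Cc := by
    intro x; simp only [pS0, hA, hB, hC]; ring
  have e1 : A * r₁ ^ 2 + B * r₁ + Cc = 0 := by rw [← key r₁, z1]; ring
  have e2 : A * r₂ ^ 2 + B * r₂ + Cc = 0 := by rw [← key r₂, z2]; ring
  have e3 : A * r₃ ^ 2 + B * r₃ + Cc = 0 := by rw [← key r₃, z3]; ring
  have f12 : A * (r₁ + r₂) + B = 0 := by
    have hm : (r₁ - r₂) * (A * (r₁ + r₂) + B) = 0 := by linear_combination e1 - e2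
    rcases mul_eq_zero.1 hm with h0 | h0
    · exact absurd (sub_eq_zero.1 h0) h12
    · exact h0
  have f13 : A * (r₁ + r₃) + B = 0 := by
    have hm : (r₁ - r₃) * (A * (r₁ + r₃) + B) = 0 := by linear_combination e1 - e3
    rcases mul_eq_zero.1 hm with h0 | h0
    · exact absurd (sub_eq_zero.1 h0) h13
    · exact h0
  have hA0 : A = 0 := by
    have hm : (r₂ - r₃) * A = 0 := by linear_combination f12 - f13
    rcases mul_eq_zero.1 hm with h0 | h0
    · exact absurd (sub_eq_zero.1 h0) h23
    · exact h0
  have hB0 : B = 0 := by linear_combination f12 - (r₁ + r₂) * hA0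
  have hC0 : Cc = 0 := by linear_combination e1 - r₁ ^ 2 * hA0 - r₁ * hB0
  have keyC : pS0C e h v z - (h : ℂ) ^ 2 * (z - r₁) * (z - r₂) * (z - r₃) =
      (A : ℂ) * z ^ 2 + (B : ℂ) * z + (Cc : ℂ) := by
    simp only [pS0C, hA, hB, hC]; push_cast; ring
  rw [hA0, hB0, hC0] at keyC
  simp only [Complex.ofReal_zero, zero_mul, add_zero] at keyC
  exact sub_eq_zero.1 keyC

/-- Continuity of `x ↦ p_{s0}(e,h,x)` (a polynomial). [folklore] -/
theorem continuous_pS0 (e h v : ℝ) : Continuous fun x => pS0 e h v x := by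
  unfold pS0; fun_prop

/-- **[CD] Thm 4.9 (1)–(3) for SCALAR TYPE 0, explicit thresholds; = Hintz (7.8) "`s0` roots:
`λ^𝓒_{s0,≪,1}, λ^𝓒_{s0,≪,2}, 1, λ^𝓒_{s0,+}`".**  For `0 < v < 1`, `0 < e ≤ v²`, `C ≥ 0`, `0 < h` with
`4h(C+1)² ≤ v`: `p_{s0}(e,h,·)` has three real roots `r₁ < r₂ < −C` and `1 < r₃`, it factors as `h²(z−r₁)(z−r₂)(z−r₃)`
over `ℂ`, so every complex root is one of them; together with the simple factor `λ − 1` of `det N_{s0}` (`det_Ms0`,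
`pS0_one_neg`) the `s0` indicial roots are exactly `r₁, r₂, 1, r₃` — precisely `2` with real part `≥ 1` and `2` with
real part `< −C`, all simple and real (CD proves this for `e ≤ e₀(v)`, `h ≤ h₀(e)` unspecified, l.4016–4017).
[cite: HintzCD2026, Thm 4.9 + App. A.2, TeX l.2419-2429 and l.3983-4017; Hintz2026, eq. (7.8), TeX l.6840] -/
theorem scalarType0_roots {e h v C : ℝ} (he : 0 < e) (hev : e ≤ v ^ 2) (hh : 0 < h) (hv : 0 < v) (hv1 : v < 1)
    (hC : 0 ≤ C) (hth : 4 * h * (C + 1) ^ 2 ≤ v) :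
    ∃ r₁ r₂ r₃ : ℝ, r₁ < r₂ ∧ r₂ < -C ∧ 1 < r₃ ∧
      pS0 e h v r₁ = 0 ∧ pS0 e h v r₂ = 0 ∧ pS0 e h v r₃ = 0 ∧
      (∀ z : ℂ, pS0C e h v z = (h : ℂ) ^ 2 * (z - r₁) * (z - r₂) * (z - r₃)) ∧
      (∀ z : ℂ, pS0C e h v z = 0 → (z = (r₁ : ℂ) ∨ z = (r₂ : ℂ) ∨ z = (r₃ : ℂ))) ∧
      (∀ x : ℝ, -C ≤ x → x ≤ 1 → pS0 e h v x ≠ 0) := by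
  have hcont := continuous_pS0 e h v
  have hhv : h ≤ v / 4 := by
    have h1' : 1 ≤ (C + 1) ^ 2 := by nlinarith
    have h2' : 4 * h ≤ 4 * h * (C + 1) ^ 2 := by nlinarith
    linarith
  -- the three probes and the interval
  have hmid : 0 < pS0 e h v (-(3 * v) / h) := pS0_mid_pos he hh hv hv1 (by linarith)
  have hleft : pS0 e h v (-(10 * v / h + 3)) < 0 := pS0_left_neg he hev hh hv hv1
  have hright : 0 < pS0 e h v (5 / (1 - v ^ 2)) := pS0_right_pos he hev hh hv hv1
  have hC' : pS0 e h v (-C) < 0 := pS0_neg_on_Icc he hev hh hv hv1 hC hth le_rfl (by linarith)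
  have hone : pS0 e h v 1 < 0 := pS0_neg_on_Icc he hev hh hv hv1 hC hth (by linarith) le_rfl
  -- ordering of the probe points
  have o1 : -(10 * v / h + 3) < -(3 * v) / h := by
    have h1 : 3 * v / h ≤ 10 * v / h := by gcongr; linarith
    have e0 : -(3 * v) / h = -((3 * v) / h) := by ring
    rw [e0]; linarith
  have o2 : -(3 * v) / h < -C := by
    -- `Ch < 3v` from `4h(C+1)² ≤ v`
    have h1 : C ≤ (C + 1) ^ 2 := by nlinarith
    have h2 : C * h < 3 * v := by nlinarith [mul_le_mul_of_nonneg_left h1 hh.le]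
    have h3 : C < 3 * v / h := by rw [lt_div_iff₀ hh]; exact h2
    have e0 : -(3 * v) / h = -((3 * v) / h) := by ring
    rw [e0]; linarith
  have o3 : (1:ℝ) < 5 / (1 - v ^ 2) := by
    have hv2 : 0 < 1 - v ^ 2 := by nlinarith
    rw [lt_div_iff₀ hv2]; nlinarith
  -- IVT three times
  obtain ⟨r₁, hr₁, z1⟩ : ∃ r ∈ Set.Ioo (-(10 * v / h + 3)) (-(3 * v) / h), pS0 e h v r = 0 := by
    have := intermediate_value_Ioo o1.le (hcont.continuousOn) (show (0:ℝ) ∈ Set.Ioo _ _ from ⟨hleft, hmid⟩)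
    exact this
  obtain ⟨r₂, hr₂, z2⟩ : ∃ r ∈ Set.Ioo (-(3 * v) / h) (-C), pS0 e h v r = 0 := by
    have := intermediate_value_Ioo' o2.le (hcont.continuousOn) (show (0:ℝ) ∈ Set.Ioo _ _ from ⟨hC', hmid⟩)
    exact this
  obtain ⟨r₃, hr₃, z3⟩ : ∃ r ∈ Set.Ioo (1:ℝ) (5 / (1 - v ^ 2)), pS0 e h v r = 0 := by
    have := intermediate_value_Ioo o3.le (hcont.continuousOn) (show (0:ℝ) ∈ Set.Ioo _ _ from ⟨hone, hright⟩)
    exact this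
  have h12 : r₁ < r₂ := lt_trans hr₁.2 hr₂.1
  have h2C : r₂ < -C := hr₂.2
  have h3 : 1 < r₃ := hr₃.1
  have n12 : r₁ ≠ r₂ := h12.ne
  have n13 : r₁ ≠ r₃ := ne_of_lt (by linarith)
  have n23 : r₂ ≠ r₃ := ne_of_lt (by linarith)
  have prod := pS0C_eq_prod n12 n13 n23 z1 z2 z3
  refine ⟨r₁, r₂, r₃, h12, h2C, h3, z1, z2, z3, prod, ?_, ?_⟩
  · intro z hz
    rw [prod z] at hz
    have hh0 : (h : ℂ) ^ 2 ≠ 0 := by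
      have : (h : ℂ) ≠ 0 := by exact_mod_cast hh.ne'
      exact pow_ne_zero 2 this
    rcases mul_eq_zero.1 hz with hz1 | hz4
    · rcases mul_eq_zero.1 hz1 with hz2 | hz3
      · rcases mul_eq_zero.1 hz2 with hz5 | hz6
        · exact absurd hz5 hh0
        · left; exact sub_eq_zero.1 hz6
      · right; left; exact sub_eq_zero.1 hz3
    · right; right; exact sub_eq_zero.1 hz4
  · intro x hx1 hx2
    exact (pS0_neg_on_Icc he hev hh hv hv1 hC hth hx1 hx2).ne

/-! ## 5. Scalar type `l ≥ 1`: the printed face polynomials and implicit-derivative values (partial) -/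

/-- Regime (N1) rescaling (CD l.4091: "`λ = h⁻¹λ̆`, … `p̆(e,h,l,λ̆) := h³p(e,h,l,h⁻¹λ̆)` has smooth coefficients"): the
polynomial `p̆`, written out from the coefficient structure of `EqMsPoly`. [cite: HintzCD2026, App. A.3 (N1), TeX l.4091-4095] -/
def pBreve (e h v L mu : ℝ) : ℝ :=
  mu ^ 6 + c5 e h v * mu ^ 5 + c4 e h v L * mu ^ 4 + c3 e h v L * mu ^ 3
    + c2 e h v L * h * mu ^ 2 + c1 e h v L * h ^ 2 * mu + c0 e h v L * h ^ 3

/-- `h³ p(e,h,l,λ̆/h) = p̆(e,h,l,λ̆)` (`h ≠ 0`), so `p̆` has polynomial ("smooth") coefficients in `h`.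
[cite: HintzCD2026, App. A.3 (N1), TeX l.4091-4095] -/
theorem N1_rescale (e v L mu : ℝ) {h : ℝ} (hh : h ≠ 0) : h ^ 3 * pS e h v L (mu / h) = pBreve e h v L mu := by
  simp only [pS, pBreve]
  field_simp
  try ring

/-- Regime (N1) face: `p̆|_{h=0} = λ̆³·(λ̆³ + 2(4−e)vλ̆² + (4(5−2e)v² − 4e)λ̆ + 8((2−e)v²−e)v)` ("has a triple root
`λ̆ = 0`", CD l.4095). [cite: HintzCD2026, App. A.3 (N1), TeX l.4095-4101] -/
theorem N1_face (e v L mu : ℝ) :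
    pBreve e 0 v L mu =
      mu ^ 3 * (mu ^ 3 + 2 * (4 - e) * v * mu ^ 2 + (4 * (5 - 2 * e) * v ^ 2 - 4 * e) * mu
        + 8 * ((2 - e) * v ^ 2 - e) * v) := by
  simp only [pBreve, c5, c4, c3, c2, c1, c0]; ring

/-- Regime (N1) at `e = 0`: "`p̆′(0,l,λ̆) = λ̆³ + 8vλ̆² + 20v²λ̆ + 16v³`, the roots of which are `−4v` (single root) and
`−2v` (double root)" (CD l.4101–4103): indeed `= (λ̆+4v)(λ̆+2v)²`. [cite: HintzCD2026, App. A.3 (N1), TeX l.4101-4103] -/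
theorem N1_face_e0 (v L mu : ℝ) : pBreve 0 0 v L mu = mu ^ 3 * ((mu + 4 * v) * (mu + 2 * v) ^ 2) := by
  rw [N1_face]; ring

/-- The printed regime-(P1) quadratic `p₁(e,l,λ)` of CD eq. `EqMsP1p1` (l.4181–4185).
[cite: HintzCD2026, App. A.3 eq. EqMsP1p1, TeX l.4181-4185 (transcription; preprint)] -/
def p1 (e v L lam : ℝ) : ℝ :=
  ((2 - e) * v ^ 2 - e) * lam ^ 2 - ((6 - e) * v ^ 2 - e) * lam
    + (4 * v ^ 2 + e * ((1 - v ^ 2) * L + 2 * (1 + v ^ 2)))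

/-- **Regime (P1):** `p(e,0,l,λ) = 8v(λ−1)·p₁(e,l,λ)` with the printed `p₁` (CD l.4181–4185).
[cite: HintzCD2026, App. A.3 eq. EqMsP1p1, TeX l.4181-4185] -/
theorem P1_factor (e v L lam : ℝ) : pS e 0 v L lam = 8 * v * (lam - 1) * p1 e v L lam := by
  simp only [pS, c5, c4, c3, c2, c1, c0, p1]; ring

/-- `p₁(0,l,λ) = 2v²(λ−2)(λ−1)` (CD l.4188–4190). [cite: HintzCD2026, App. A.3 (P1), TeX l.4188-4190] -/
theorem p1_e0 (v L lam : ℝ) : p1 0 v L lam = 2 * v ^ 2 * ((lam - 2) * (lam - 1)) := by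
  simp only [p1]; ring

/-- First-order Taylor data of `p₁` at `(e,λ) = (0,1)`: `p₁(e,l,1) = e·((1−v²)L + 2(1+v²))` (exactly linear in `e`,
`p₁(0,l,1) = 0`) and `p₁(0,l,1+m) = −2v²·m + 2v²·m²`; i.e. `∂_e p₁|_{(0,1)} = (1−v²)L + 2(1+v²)`,
`∂_λ p₁|_{(0,1)} = −2v²`. [folklore] -/
theorem P1_taylor_e (e v L m : ℝ) :
    p1 e v L 1 = e * ((1 - v ^ 2) * L + 2 * (1 + v ^ 2)) ∧
      p1 0 v L (1 + m) = -(2 * v ^ 2) * m + 2 * v ^ 2 * m ^ 2 := by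
  constructor <;> · simp only [p1]; ring

/-- **The printed value `∂_e λ_{1,1}(e,l)|_{e=0} = ((1−v²)l(l+1) + 2(1+v²))/(2v²)`** (CD l.4193) is `−∂_e p₁/∂_λ p₁`
at `(0,1)` with the Taylor data of `P1_taylor_e` (`v ≠ 0`); and it is `≥ 2/v²` for `L ≥ 2`, `v² ≤ 1` (CD: "`≥ 2/v² > 0`
(Here, we used `l(l+1) ≥ 2`.)"). [cite: HintzCD2026, App. A.3 (P1), TeX l.4190-4194] -/
theorem P1_dE_value {v : ℝ} (hv : v ≠ 0) (L : ℝ) :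
    -((1 - v ^ 2) * L + 2 * (1 + v ^ 2)) / (-(2 * v ^ 2)) = ((1 - v ^ 2) * L + 2 * (1 + v ^ 2)) / (2 * v ^ 2) ∧
      (2 ≤ L → v ^ 2 ≤ 1 → 2 / v ^ 2 ≤ ((1 - v ^ 2) * L + 2 * (1 + v ^ 2)) / (2 * v ^ 2)) := by
  refine ⟨by rw [neg_div_neg_eq], fun hL hv1 => ?_⟩
  have hv2 : 0 < v ^ 2 := by positivity
  have e0 : 2 / v ^ 2 = 4 / (2 * v ^ 2) := by field_simp; ring
  rw [e0]
  gcongr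
  nlinarith

/-- First-order Taylor data of the sextic at `(h,λ) = (0,1)`: `p(e,h,l,1) = −4e(1−v²)L(L−2)·h + h²·(2L²v − 4Lv + (2L² − L³)h)`
(so `∂_h p|_{h=0,λ=1} = −4e(1−v²)L(L−2)`), and at `h = 0`: `∂_λ p(e,0,l,·)|_{λ=1} = 8v·p₁(e,l,1) = 8ve((1−v²)L + 2(1+v²))`
(from `P1_factor`, `P1_taylor_e`). [folklore] -/
theorem P1_taylor_h (e h v L : ℝ) :
    pS e h v L 1 = -(4 * e * (1 - v ^ 2) * L * (L - 2)) * h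
      + h ^ 2 * (2 * L ^ 2 * v - 4 * L * v + (2 * L ^ 2 - L ^ 3) * h) := by
  simp only [pS, c5, c4, c3, c2, c1, c0]; ring

/-- See `P1_taylor_h`: the `λ`-derivative datum at `h = 0`, as an exact expansion in `m = λ − 1`:
`p(e,0,l,1+m) = 8ve((1−v²)L + 2(1+v²))·m + m²·R` with an explicit polynomial `R`. [folklore] -/
theorem P1_taylor_lam (e v L m : ℝ) :
    pS e 0 v L (1 + m) = 8 * v * e * ((1 - v ^ 2) * L + 2 * (1 + v ^ 2)) * m
      + m ^ 2 * (8 * v * ((-2 * v ^ 2 - e * v ^ 2 - e) + m * ((2 - e) * v ^ 2 - e))) := by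
  simp only [pS, c5, c4, c3, c2, c1, c0]; ring

/-- **The printed value `∂_h λ₀(e,h,l)|_{h=0} = (l−1)l(l+1)(l+2)(1−v²) / (2v((1−v²)l(l+1) + 2(1+v²)))`** (CD l.4203–4205)
is `−∂_h p/∂_λ p` at `(h,λ) = (0,1)` with the data of `P1_taylor_h`/`P1_taylor_lam`; the factor `e` CANCELS
("being independent of `e`", l.4205; footnote l.4205), for `e ≠ 0`, `v ≠ 0` and a non-vanishing denominator; here
`(l−1)l(l+1)(l+2) = L(L−2)`.  Its value at `l = 2` (`L = 6`) is the printed "explicit lower bound `3(1−v²)/(v(2−v²))`"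
(l.4205) and the printed usable constant `c = 2(1−v²)/(v(2−v²))` (l.4207) is `2/3` of it.
[cite: HintzCD2026, App. A.3 (P1), TeX l.4200-4208] -/
theorem P1_dH_value {e v L : ℝ} (he : e ≠ 0) (hv : v ≠ 0) (hden : (1 - v ^ 2) * L + 2 * (1 + v ^ 2) ≠ 0) :
    -(-(4 * e * (1 - v ^ 2) * L * (L - 2))) / (8 * v * e * ((1 - v ^ 2) * L + 2 * (1 + v ^ 2))) =
        L * (L - 2) * (1 - v ^ 2) / (2 * v * ((1 - v ^ 2) * L + 2 * (1 + v ^ 2))) := by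
  field_simp
  ring

/-- The printed "explicit lower bound `3(1−v²)/(v(2−v²))`" (CD l.4205) is the value of `P1_dH_value` at `l = 2`
(`L = 6`, `L(L−2) = 24`), stated cross-multiplied (no side conditions), and the printed usable constant
`c = 2(1−v²)/(v(2−v²))` (l.4207) is two thirds of it. [cite: HintzCD2026, App. A.3 (P1), TeX l.4205-4208] -/
theorem P1_dH_value_l2 (v : ℝ) :
    (6:ℝ) * (6 - 2) * (1 - v ^ 2) * (v * (2 - v ^ 2)) = 3 * (1 - v ^ 2) * (2 * v * ((1 - v ^ 2) * 6 + 2 * (1 + v ^ 2))) ∧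
      2 * (1 - v ^ 2) / (v * (2 - v ^ 2)) = 2 / 3 * (3 * (1 - v ^ 2) / (v * (2 - v ^ 2))) := by
  constructor <;> ring

/-- The printed regime-(P2) face cubic `EqMsP2Poly` (CD l.4249–4252):
`p′(e′,h′,0,λ) = (2vλ − 2v − h′)(8v²λ² − 6v(4v+h′)λ + (4(4−e′)v² + 4h′v + h′² + 4e′))`.
[cite: HintzCD2026, App. A.3 eq. EqMsP2Poly, TeX l.4249-4252 (transcription; preprint)] -/
def P2face (ep hp v lam : ℝ) : ℝ :=
  (2 * v * lam - 2 * v - hp) * (8 * v ^ 2 * lam ^ 2 - 6 * v * (4 * v + hp) * lam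
    + (4 * (4 - ep) * v ^ 2 + 4 * hp * v + hp ^ 2 + 4 * ep))

/-- "Its restriction to `h′ = 0` is still cubic, `p′(e′,0,0,λ) = 16v³(λ−1)[λ² − 3λ + (2 + e′(1−v²)/(2v²))]`" (CD l.4253–4256),
`v ≠ 0`. [cite: HintzCD2026, App. A.3 (P2), TeX l.4249-4256] -/
theorem P2_face_h0 (ep lam : ℝ) {v : ℝ} (hv : v ≠ 0) :
    P2face ep 0 v lam = 16 * v ^ 3 * (lam - 1) * (lam ^ 2 - 3 * lam + (2 + ep * (1 - v ^ 2) / (2 * v ^ 2))) := by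
  unfold P2face; field_simp; ring

/-- `EqMsP2Roots` (CD l.4255–4262): `λ_{1/2}(e′,0,0) = 3/2 ± ½√(1 − 2e′(1−v²)/v²)` are the roots of that quadratic when the
radicand is non-negative; for `e′(1−v²)/v² > ½` ("`e′ = el² > v²/(2(1−v²))`") the roots are non-real with real part `3/2`
— here: the quadratic has no real root then (its value is `> 0` everywhere). [cite: HintzCD2026, App. A.3 eq. EqMsP2Roots, TeX l.4253-4262] -/
theorem P2_roots (ep : ℝ) {v : ℝ} (hv : v ≠ 0) :
    (0 ≤ 1 - 2 * ep * (1 - v ^ 2) / v ^ 2 →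
      ∀ s : ℝ, s = Real.sqrt (1 - 2 * ep * (1 - v ^ 2) / v ^ 2) →
        (3 / 2 + s / 2) ^ 2 - 3 * (3 / 2 + s / 2) + (2 + ep * (1 - v ^ 2) / (2 * v ^ 2)) = 0 ∧
        (3 / 2 - s / 2) ^ 2 - 3 * (3 / 2 - s / 2) + (2 + ep * (1 - v ^ 2) / (2 * v ^ 2)) = 0) ∧
    (1 - 2 * ep * (1 - v ^ 2) / v ^ 2 < 0 →
      ∀ lam : ℝ, 0 < lam ^ 2 - 3 * lam + (2 + ep * (1 - v ^ 2) / (2 * v ^ 2))) := by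
  constructor
  · intro hrad s hs
    have hs2 : s ^ 2 = 1 - 2 * ep * (1 - v ^ 2) / v ^ 2 := by rw [hs]; exact Real.sq_sqrt hrad
    constructor
    · have : (3 / 2 + s / 2) ^ 2 - 3 * (3 / 2 + s / 2) + (2 + ep * (1 - v ^ 2) / (2 * v ^ 2)) =
          (s ^ 2 - (1 - 2 * ep * (1 - v ^ 2) / v ^ 2)) / 4 := by field_simp; ring
      rw [this, hs2]; ring
    · have : (3 / 2 - s / 2) ^ 2 - 3 * (3 / 2 - s / 2) + (2 + ep * (1 - v ^ 2) / (2 * v ^ 2)) =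
          (s ^ 2 - (1 - 2 * ep * (1 - v ^ 2) / v ^ 2)) / 4 := by field_simp; ring
      rw [this, hs2]; ring
  · intro hrad lam
    have : lam ^ 2 - 3 * lam + (2 + ep * (1 - v ^ 2) / (2 * v ^ 2)) =
        (lam - 3 / 2) ^ 2 - (1 - 2 * ep * (1 - v ^ 2) / v ^ 2) / 4 := by field_simp; ring
    rw [this]
    nlinarith [sq_nonneg (lam - 3 / 2)]

/-- The printed regime-(P4) face cubic (CD l.4355): `p̃(ẽ,0,0,λ̃) = (2vλ̃ − 1)(8v²λ̃² − 6vλ̃ + (4(1−v²)ẽ + 1))`, with roots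
`1/(2v)` and `(3 ± √(1 − 32(1−v²)ẽ))/(8v)` (l.4359–4360), real iff `ẽ ≤ 1/(32(1−v²))`; `v ≠ 0`.
[cite: HintzCD2026, App. A.3 (P4), TeX l.4350-4363 (transcription; preprint)] -/
theorem P4_roots (te : ℝ) {v : ℝ} (hv : v ≠ 0) :
    (2 * v * (1 / (2 * v)) - 1 = 0) ∧
    (0 ≤ 1 - 32 * (1 - v ^ 2) * te →
      ∀ s : ℝ, s = Real.sqrt (1 - 32 * (1 - v ^ 2) * te) →
        8 * v ^ 2 * ((3 + s) / (8 * v)) ^ 2 - 6 * v * ((3 + s) / (8 * v)) + (4 * (1 - v ^ 2) * te + 1) = 0 ∧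
        8 * v ^ 2 * ((3 - s) / (8 * v)) ^ 2 - 6 * v * ((3 - s) / (8 * v)) + (4 * (1 - v ^ 2) * te + 1) = 0) := by
  refine ⟨by rw [mul_one_div, div_self (mul_ne_zero two_ne_zero hv), sub_self], fun hrad s hs => ?_⟩
  have hs2 : s ^ 2 = 1 - 32 * (1 - v ^ 2) * te := by rw [hs]; exact Real.sq_sqrt hrad
  constructor
  · have : 8 * v ^ 2 * ((3 + s) / (8 * v)) ^ 2 - 6 * v * ((3 + s) / (8 * v)) + (4 * (1 - v ^ 2) * te + 1) =
        (s ^ 2 - (1 - 32 * (1 - v ^ 2) * te)) / 8 := by field_simp; ring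
    rw [this, hs2]; ring
  · have : 8 * v ^ 2 * ((3 - s) / (8 * v)) ^ 2 - 6 * v * ((3 - s) / (8 * v)) + (4 * (1 - v ^ 2) * te + 1) =
        (s ^ 2 - (1 - 32 * (1 - v ^ 2) * te)) / 8 := by field_simp; ring
    rw [this, hs2]; ring

end Literature.Geometry.Lorentzian.Hintz2026.ConstraintDampingRoots
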